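import Summits.SmoothPoincare4.SmoothPoincare4.Theorems.ConvexBisectionAcyclicBisectionExistsPageTubeField
import Summits.SmoothPoincare4.SmoothPoincare4.Theorems.ConvexBisectionAcyclicBisectionExistsPageTwistingTransverseLoop
import Literature.Topology.FourManifolds.CircleLoops
import HarnessLib

/-!
# The page-adapted tube map of a page curve in the Lefschetz base
(wave 3, worker Z4, brick T3c-1 (3b) "page-adapted circle tube", part 2, of stub
`stub_steinRealisation` = NF6 `Literature.Geometry.Symplectic.steinRealisation_of_sorted_modelsOnFibred`,
line `modp-braid-orbits` r11, crux `ConvexBisection.AcyclicBisectionExists`, item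
stmt-SmoothPoincare4-10508; registered sub-goal `helper_pageTube_inPage`)

Sequel of `…PageTubeField.lean` (the parametrised in-page field `pageFieldP g δ` on `ℝ⁴ × ℂ`, its
flow `Θ`: `m`, `rho`, `w` invariant).  For a smooth embedding `K : 𝕊¹ → Base g` into a page
`page g c` this file builds the TUBE MAP `(ψ, (a, b)) ↦ R_b (P_a ψ)` of the page-adapted tube
(Kosinski 1993, III (3.1)) as a smooth map `𝕊¹ × ℝ² → ∂ Base g`:
* §1 `circleFn f` — a `1`-periodic function of the angle read on the circle (through the angle
  `angA` of `TorusCoordinates.lean`), smooth when `f` is (descent along `circlePoint`);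
* §2 the IN-PAGE NORMAL COEFFICIENT: for `T` in the complex tangent line `ker dΦ_q` of the page,
  `normalCoef g q T ⋆ s(q) = i T` (`kerVec_normalCoef`, `s = (∂Φ/∂y, −∂Φ/∂x)`); along `K` the
  velocity is `ℂ`-tangent to the page, so `velCoef g K t` is a smooth `1`-periodic function with
  `velCoef ⋆ s = i K'`, the in-page normal; read on the circle and scaled into the unit disc it is
  the parameter `mPar g K C : 𝕊¹ → ℂ` fed to the flow (`kerVec_mPar`, `exists_norm_mPar_le`);
* §3 the maps `inPageAmb Θ K m (ψ, a) = (Θ (a, (K ψ, m ψ))).1` (in-page tube) and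
  `tubeAmb θ Θ K m (ψ, v) = θ (v₁, inPageAmb Θ K m (ψ, v₀))` (then the page-rotation flow `θ`),
  smooth into `ℝ⁴`, on `{rho = 1/4}`, equal to `K` on the zero section; the corestriction `tubeMap`
  to `∂ Base g` is smooth for the boundary structure (`contMDiff_tubeMap`);
* §4 the registered package `helper_pageTube_inPage`: the smooth in-page tube of a page curve.

Everything is proved; no named facts, no `sorry`.  References: A. A. Kosinski, *Differential
Manifolds* (1993), III (3.1) [Kosinski1993]; J. M. Lee, *Introduction to Smooth Manifolds* (2012),
Thm. 9.16, Cor. 5.30 [LeeSmoothManifolds2013].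
-/

noncomputable section

set_option linter.dupNamespace false

open scoped Manifold ContDiff Topology ComplexConjugate
open Set Function Metric
open Literature.Topology.FourManifolds Literature.Topology.FourManifolds.LefschetzBase
open Literature.Geometry.Symplectic

namespace Summit.SmoothPoincare4.SmoothPoincare4.Theorems.AcyclicBisectionExists.ModpBraidOrbits

variable {g : ℕ}

/-! ## §1 Reading a `1`-periodic function on the circle -/

/-- A function of the unit-period angle `t` (`circlePt t = e^{2πit}`), read on the circle through
the angle function `angA`. [folklore] -/
def circleFn {X : Type*} (f : ℝ → X) (u : sphere (0 : EuclideanSpace ℝ (Fin 2)) 1) : X := f (angA u)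

/-- A `1`-periodic function read on the circle lifts back to itself. [folklore] -/
theorem circleFn_circlePt {X : Type*} {f : ℝ → X} (hf : Periodic f 1) (t : ℝ) :
    circleFn f (circlePt t) = f t := by
  obtain ⟨m, hm⟩ := circlePt_eq_circlePt_iff.1 (circlePt_angA (circlePt t))
  rw [circleFn, hm]
  have h := hf.int_mul m t
  rwa [mul_one] at h

/-- **A smooth `1`-periodic function read on the circle is smooth** (smoothness descends along the
covering `circlePoint`, `contMDiffAt_of_comp_circlePoint`). [folklore] -/
theorem contMDiff_circleFn {E' H' : Type*} [NormedAddCommGroup E'] [NormedSpace ℝ E']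
    [TopologicalSpace H'] {J : ModelWithCorners ℝ E' H'} {N : Type*} [TopologicalSpace N]
    [ChartedSpace H' N] {f : ℝ → N} (hf : ContMDiff 𝓘(ℝ, ℝ) J ∞ f) (hper : Periodic f 1) :
    ContMDiff (𝓡 1) J ∞ (circleFn f) := by
  intro u
  obtain ⟨θ, rfl⟩ := circlePoint_surjective u
  apply contMDiffAt_of_comp_circlePoint
  have heq : circleFn f ∘ circlePoint = f ∘ fun θ : ℝ => θ / (2 * Real.pi) := by
    funext θ
    have h := circleFn_circlePt hper (θ / (2 * Real.pi))
    rwa [circlePt_eq_circlePoint, mul_div_cancel₀ _ Real.two_pi_pos.ne'] at h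
  rw [heq]
  exact (hf.comp (contDiff_id.div_const _).contMDiff).contMDiffAt

/-! ## §2 The in-page normal coefficient along a page curve -/

/-- The standard Hermitian product `x_V x̄_U + y_V ȳ_U` of `ℂ² = ℝ⁴`. [folklore] -/
def herm (V U : EuclideanSpace ℝ (Fin 4)) : ℂ := cx V * conj (cx U) + cy V * conj (cy U)

/-- `‖dΦ_q‖² = ‖∂Φ/∂x‖² + ‖∂Φ/∂y‖² = ‖s(q)‖²`. [folklore] -/
def dPhiNormSq (g : ℕ) (q : EuclideanSpace ℝ (Fin 4)) : ℝ := ‖dPhiX g q‖ ^ 2 + ‖dPhiY q‖ ^ 2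

/-- **The in-page normal coefficient** `i ⟨T, s(q)⟩ / ‖s(q)‖²` of a vector `T` at `q`. [folklore] -/
def normalCoef (g : ℕ) (q T : EuclideanSpace ℝ (Fin 4)) : ℂ :=
  (dPhiNormSq g q)⁻¹ • (Complex.I * herm T (kerVec g q 1))

/-- **For `T` in the complex tangent line `ker dΦ_q` of the page, `normalCoef q T ⋆ s(q) = i T`**, the
in-page normal of `T` (`T = μ s` with `μ = ⟨T, s⟩/‖s‖²` since `ker dΦ_q = ℂ · s(q)`). [folklore] -/
theorem kerVec_normalCoef {q T : EuclideanSpace ℝ (Fin 4)} (hq : q ≠ 0)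
    (hT : dPhiX g q * cx T + dPhiY q * cy T = 0) :
    kerVec g q (normalCoef g q T) = cplxJ T := by
  have hN : ((dPhiNormSq g q : ℝ) : ℂ) ≠ 0 := by exact_mod_cast normSq_dPhi_ne_zero (g := g) hq
  have ha : dPhiX g q * conj (dPhiX g q) = ((‖dPhiX g q‖ : ℝ) : ℂ) ^ 2 := Complex.mul_conj' _
  have hb : dPhiY q * conj (dPhiY q) = ((‖dPhiY q‖ : ℝ) : ℂ) ^ 2 := Complex.mul_conj' _
  have keyx : Complex.I * herm T (kerVec g q 1) * dPhiY q =
      Complex.I * cx T * ((dPhiNormSq g q : ℝ) : ℂ) := by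
    rw [herm, cx_kerVec, cy_kerVec, one_mul, one_mul, dPhiNormSq]
    push_cast
    rw [map_neg]
    linear_combination (-Complex.I * conj (dPhiX g q)) * hT + (Complex.I * cx T) * ha +
      (Complex.I * cx T) * hb
  have keyy : Complex.I * herm T (kerVec g q 1) * (-dPhiX g q) =
      Complex.I * cy T * ((dPhiNormSq g q : ℝ) : ℂ) := by
    rw [herm, cx_kerVec, cy_kerVec, one_mul, one_mul, dPhiNormSq]
    push_cast
    rw [map_neg]
    linear_combination (-Complex.I * conj (dPhiY q)) * hT + (Complex.I * cy T) * ha +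
      (Complex.I * cy T) * hb
  apply ext_cx_cy
  · rw [cx_kerVec, cx_cplxJ, normalCoef, Complex.real_smul, mul_assoc, keyx, Complex.ofReal_inv]
    field_simp
  · rw [cy_kerVec, cy_cplxJ, normalCoef, Complex.real_smul, ← mul_neg, mul_assoc, keyy,
      Complex.ofReal_inv]
    field_simp

/-- Real multiples pass through `⋆ s`. [folklore] -/
theorem kerVec_smul (q : EuclideanSpace ℝ (Fin 4)) (r : ℝ) (m : ℂ) :
    kerVec g q (r • m) = r • kerVec g q m := by
  apply ext_cx_cy
  · rw [cx_kerVec, cx_smul, cx_kerVec, Complex.real_smul]; ring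
  · rw [cy_kerVec, cy_smul, cy_kerVec, Complex.real_smul]; ring

/-- **The velocity coefficient** of a loop `K` in the base at the unit-period parameter `t`:
`normalCoef` of the ambient velocity `(ambCurve g K)' (t)` at `K (e^{2πit})`. [folklore] -/
def velCoef (g : ℕ) (K : sphere (0 : EuclideanSpace ℝ (Fin 2)) 1 → Base g) (t : ℝ) : ℂ :=
  normalCoef g (ambCurve g K t) (deriv (ambCurve g K) t)

section Coef

variable {K : sphere (0 : EuclideanSpace ℝ (Fin 2)) 1 → Base g} {c : ℂ}

/-- The velocity coefficient has period `1`. [folklore] -/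
theorem periodic_velCoef : Periodic (velCoef g K) 1 := fun t => by
  simp only [velCoef, ambCurve_add_one, deriv_ambCurve_add_one]

/-- The ambient unit-period parametrisation of a smooth loop is smooth. [folklore] -/
theorem contDiff_ambCurve_top (hK : ContMDiff (𝓡 1) (𝓡∂ 4) ∞ K) : ContDiff ℝ ∞ (ambCurve g K) := by
  have h : ContMDiff 𝓘(ℝ, ℝ) (𝓡 4) ∞ (ambCurve g K) :=
    (RegularSublevel.contMDiff_incl (isRegularLevel_rho g)).comp (hK.comp contMDiff_circlePt)
  exact contMDiff_iff_contDiff.1 h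

/-- The Hermitian product of smooth vector functions is smooth. [folklore] -/
theorem contDiff_herm {E : Type*} [NormedAddCommGroup E] [NormedSpace ℝ E]
    {f h : E → EuclideanSpace ℝ (Fin 4)} (hf : ContDiff ℝ ∞ f) (hh : ContDiff ℝ ∞ h) :
    ContDiff ℝ ∞ fun x => herm (f x) (h x) :=
  ((contDiff_cx.comp hf).mul (Complex.conjCLE.contDiff.comp (contDiff_cx.comp hh))).add
    ((contDiff_cy.comp hf).mul (Complex.conjCLE.contDiff.comp (contDiff_cy.comp hh)))

/-- **The velocity coefficient of a smooth loop is smooth** (`‖dΦ‖ ≠ 0` on the base, which misses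
the origin). [folklore] -/
theorem contDiff_velCoef (hK : ContMDiff (𝓡 1) (𝓡∂ 4) ∞ K) : ContDiff ℝ ∞ (velCoef g K) := by
  have hc := contDiff_ambCurve_top (g := g) hK
  have hd : ContDiff ℝ ∞ (deriv (ambCurve g K)) := (contDiff_infty_iff_deriv.1 hc).2
  have hN : ContDiff ℝ ∞ fun t => (dPhiNormSq g (ambCurve g K t))⁻¹ :=
    (((contDiff_norm_sq_complex.comp (contDiff_dPhiX g)).add
      (contDiff_norm_sq_complex.comp contDiff_dPhiY)).comp hc).inv
      fun t => normSq_dPhi_ne_zero (coe_ne_zero (K (circlePt t)))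
  have hs : ContDiff ℝ ∞ fun t => kerVec g (ambCurve g K t) 1 :=
    (contDiff_kerVec g).comp (hc.prodMk contDiff_const)
  exact hN.smul (contDiff_const.mul (contDiff_herm hd hs))

/-- **Along a page curve, `velCoef ⋆ s = i K'`**: the velocity is `ℂ`-tangent to the page.
[folklore] -/
theorem kerVec_velCoef (hK : ContMDiff (𝓡 1) (𝓡∂ 4) ∞ K) (hKc : ∀ θ, K θ ∈ page g c) (t : ℝ) :
    kerVec g (ambCurve g K t) (velCoef g K t) = cplxJ (deriv (ambCurve g K) t) :=
  kerVec_normalCoef (coe_ne_zero (K (circlePt t)))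
    (dPhi_velocity_eq_zero_of_page hKc
      (hasDerivAt_ambCurve (hK.mdifferentiableAt (by simp))).differentiableAt.hasDerivAt)

/-- **The circle parameter** `ψ ↦ C⁻¹ · velCoef` read on the circle (scaled by `C⁻¹` into the unit
disc, where the parameter cut-off `parCut` is `1`). [folklore] -/
def mPar (g : ℕ) (K : sphere (0 : EuclideanSpace ℝ (Fin 2)) 1 → Base g) (C : ℝ)
    (ψ : sphere (0 : EuclideanSpace ℝ (Fin 2)) 1) : ℂ :=
  (C⁻¹ : ℝ) • circleFn (velCoef g K) ψ

/-- The circle parameter is smooth. [folklore] -/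
theorem contMDiff_mPar (hK : ContMDiff (𝓡 1) (𝓡∂ 4) ∞ K) (C : ℝ) :
    ContMDiff (𝓡 1) 𝓘(ℝ, ℂ) ∞ (mPar g K C) :=
  (((C⁻¹ : ℝ) • ContinuousLinearMap.id ℝ ℂ).contMDiff).comp
    (contMDiff_circleFn (contDiff_velCoef hK).contMDiff periodic_velCoef)

/-- The circle parameter over an angle. [folklore] -/
theorem mPar_circlePt (C t : ℝ) : mPar g K C (circlePt t) = (C⁻¹ : ℝ) • velCoef g K t := by
  rw [mPar, circleFn_circlePt periodic_velCoef]

/-- **The in-page vector of the circle parameter is `C⁻¹ · i K'`.** [folklore] -/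
theorem kerVec_mPar (hK : ContMDiff (𝓡 1) (𝓡∂ 4) ∞ K) (hKc : ∀ θ, K θ ∈ page g c) (C t : ℝ) :
    kerVec g (ambCurve g K t) (mPar g K C (circlePt t)) = (C⁻¹ : ℝ) • cplxJ (deriv (ambCurve g K) t) := by
  rw [mPar_circlePt, kerVec_smul, kerVec_velCoef hK hKc]

/-- **A scale putting the circle parameter in the unit disc** (compactness of the circle).
[folklore] -/
theorem exists_norm_mPar_le (hK : ContMDiff (𝓡 1) (𝓡∂ 4) ∞ K) :
    ∃ C : ℝ, 0 < C ∧ ∀ ψ, ‖mPar g K C ψ‖ ≤ 1 := by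
  have hcont : Continuous fun ψ => ‖circleFn (velCoef g K) ψ‖ :=
    (contMDiff_circleFn (contDiff_velCoef hK).contMDiff periodic_velCoef).continuous.norm
  obtain ⟨ψ₀, -, hmax⟩ := isCompact_univ.exists_isMaxOn ⟨ptA, mem_univ _⟩ hcont.continuousOn
  set M := ‖circleFn (velCoef g K) ψ₀‖ with hM
  refine ⟨M + 1, by positivity, fun ψ => ?_⟩
  have hle : ‖circleFn (velCoef g K) ψ‖ ≤ M := hmax (mem_univ ψ)
  rw [mPar, norm_smul, Real.norm_eq_abs, abs_of_pos (by positivity), inv_mul_le_iff₀ (by positivity)]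
  linarith [norm_nonneg (circleFn (velCoef g K) ψ₀)]

/-- **A width `δ > 0` with `‖x(K ψ)‖² ≤ 4 − δ` along a curve in a page** (the page is the OPEN
part `‖x‖² < 4`; compactness of the circle). [folklore] -/
theorem exists_width (hK : ContMDiff (𝓡 1) (𝓡∂ 4) ∞ K) (hKc : ∀ θ, K θ ∈ page g c) :
    ∃ δ : ℝ, 0 < δ ∧ ∀ ψ, ‖cx (K ψ).1‖ ^ 2 ≤ 4 - δ := by
  have hcont : Continuous fun ψ => ‖cx (K ψ).1‖ ^ 2 :=
    ((contDiff_cx.continuous.comp ((RegularSublevel.continuous_incl _).comp hK.continuous)).norm).pow 2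
  obtain ⟨ψ₀, -, hmax⟩ := isCompact_univ.exists_isMaxOn ⟨ptA, mem_univ _⟩ hcont.continuousOn
  refine ⟨4 - ‖cx (K ψ₀).1‖ ^ 2, by linarith [(hKc ψ₀).1], fun ψ => ?_⟩
  have hle : ‖cx (K ψ).1‖ ^ 2 ≤ ‖cx (K ψ₀).1‖ ^ 2 := hmax (mem_univ ψ)
  linarith

end Coef

/-! ## §3 The in-page tube map and the full tube map -/

section Maps

variable (θ : ℝ × EuclideanSpace ℝ (Fin 4) → EuclideanSpace ℝ (Fin 4))
  (Θ : ℝ × (EuclideanSpace ℝ (Fin 4) × ℂ) → EuclideanSpace ℝ (Fin 4) × ℂ)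
  (K : sphere (0 : EuclideanSpace ℝ (Fin 2)) 1 → Base g) (m : sphere (0 : EuclideanSpace ℝ (Fin 2)) 1 → ℂ)

/-- **The in-page tube map** `(ψ, a) ↦ (Θ (a, (K ψ, m ψ))).1 ∈ ℝ⁴`: flow for time `a` of the
in-page field with parameter `m ψ`, started at `K ψ`. [cite: Kosinski1993, III (3.1)] -/
def inPageAmb (q : sphere (0 : EuclideanSpace ℝ (Fin 2)) 1 × ℝ) : EuclideanSpace ℝ (Fin 4) :=
  (Θ (q.2, ((K q.1).1, m q.1))).1

/-- **The tube map** `(ψ, v) ↦ θ (v₁, inPageAmb (ψ, v₀)) ∈ ℝ⁴`: the in-page tube followed by the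
page-rotation flow `θ` for time `v₁`. [cite: Kosinski1993, III (3.1)] -/
def tubeAmb (q : sphere (0 : EuclideanSpace ℝ (Fin 2)) 1 × EuclideanSpace ℝ (Fin 2)) :
    EuclideanSpace ℝ (Fin 4) :=
  θ (q.2 1, inPageAmb Θ K m (q.1, q.2 0))

variable {θ Θ K m} {c : ℂ}

/-- Pairing two smooth maps into vector spaces, as a smooth map into the product vector space.
[folklore] -/
theorem contMDiff_prodMk_vec {E₁ E₂ : Type*} [NormedAddCommGroup E₁] [NormedSpace ℝ E₁]
    [NormedAddCommGroup E₂] [NormedSpace ℝ E₂] {EM HM : Type*} [NormedAddCommGroup EM] [NormedSpace ℝ EM]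
    [TopologicalSpace HM] {IM : ModelWithCorners ℝ EM HM} {M : Type*} [TopologicalSpace M]
    [ChartedSpace HM M] {f : M → E₁} {h : M → E₂} (hf : ContMDiff IM 𝓘(ℝ, E₁) ∞ f)
    (hh : ContMDiff IM 𝓘(ℝ, E₂) ∞ h) :
    ContMDiff IM 𝓘(ℝ, E₁ × E₂) ∞ fun x => (f x, h x) := by
  rw [modelWithCornersSelf_prod, ← chartedSpaceSelf_prod]
  exact hf.prodMk hh

/-- A coordinate of the fibre vector is a smooth function on the tube. [folklore] -/
theorem contMDiff_snd_coord (i : Fin 2) :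
    ContMDiff ((𝓡 1).prod 𝓘(ℝ, EuclideanSpace ℝ (Fin 2))) 𝓘(ℝ, ℝ) ∞
      fun q : sphere (0 : EuclideanSpace ℝ (Fin 2)) 1 × EuclideanSpace ℝ (Fin 2) => q.2 i :=
  (EuclideanSpace.proj (𝕜 := ℝ) i).contMDiff.comp contMDiff_snd

/-- **The in-page tube map is smooth.** [folklore] -/
theorem contMDiff_inPageAmb (hΘ : ContDiff ℝ ∞ Θ) (hK : ContMDiff (𝓡 1) (𝓡∂ 4) ∞ K)
    (hm : ContMDiff (𝓡 1) 𝓘(ℝ, ℂ) ∞ m) :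
    ContMDiff ((𝓡 1).prod 𝓘(ℝ, ℝ)) 𝓘(ℝ, EuclideanSpace ℝ (Fin 4)) ∞ (inPageAmb Θ K m) := by
  have hKa : ContMDiff (𝓡 1) 𝓘(ℝ, EuclideanSpace ℝ (Fin 4)) ∞ fun ψ => (K ψ).1 :=
    (RegularSublevel.contMDiff_incl (isRegularLevel_rho g)).comp hK
  have h1 : ContMDiff ((𝓡 1).prod 𝓘(ℝ, ℝ)) 𝓘(ℝ, ℝ × (EuclideanSpace ℝ (Fin 4) × ℂ)) ∞
      fun q : sphere (0 : EuclideanSpace ℝ (Fin 2)) 1 × ℝ => (q.2, ((K q.1).1, m q.1)) :=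
    contMDiff_prodMk_vec contMDiff_snd
      (contMDiff_prodMk_vec (hKa.comp contMDiff_fst) (hm.comp contMDiff_fst))
  exact (ContinuousLinearMap.fst ℝ (EuclideanSpace ℝ (Fin 4)) ℂ).contMDiff.comp
    (hΘ.contMDiff.comp h1)

/-- **The tube map is smooth.** [folklore] -/
theorem contMDiff_tubeAmb (hθ : ContDiff ℝ ∞ θ) (hΘ : ContDiff ℝ ∞ Θ)
    (hK : ContMDiff (𝓡 1) (𝓡∂ 4) ∞ K) (hm : ContMDiff (𝓡 1) 𝓘(ℝ, ℂ) ∞ m) :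
    ContMDiff ((𝓡 1).prod 𝓘(ℝ, EuclideanSpace ℝ (Fin 2))) 𝓘(ℝ, EuclideanSpace ℝ (Fin 4)) ∞
      (tubeAmb θ Θ K m) := by
  have hP := contMDiff_inPageAmb hΘ hK hm
  have h0 : ContMDiff ((𝓡 1).prod 𝓘(ℝ, EuclideanSpace ℝ (Fin 2))) ((𝓡 1).prod 𝓘(ℝ, ℝ)) ∞
      fun q : sphere (0 : EuclideanSpace ℝ (Fin 2)) 1 × EuclideanSpace ℝ (Fin 2) => (q.1, q.2 0) :=
    contMDiff_fst.prodMk (contMDiff_snd_coord 0)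
  have h1 : ContMDiff ((𝓡 1).prod 𝓘(ℝ, EuclideanSpace ℝ (Fin 2))) 𝓘(ℝ, ℝ × EuclideanSpace ℝ (Fin 4)) ∞
      fun q : sphere (0 : EuclideanSpace ℝ (Fin 2)) 1 × EuclideanSpace ℝ (Fin 2) =>
        (q.2 1, inPageAmb Θ K m (q.1, q.2 0)) :=
    contMDiff_prodMk_vec (contMDiff_snd_coord 1) (hP.comp h0)
  exact hθ.contMDiff.comp h1

variable (h0Θ : ∀ z, Θ (0, z) = z) (hrhoΘ : ∀ t z, rho g (Θ (t, z)).1 = rho g z.1)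
  (hwΘ : ∀ t z, w g (Θ (t, z)).1 = w g z.1)
  (h0θ : ∀ x, θ (0, x) = x) (hrhoθ : ∀ t x, rho g (θ (t, x)) = rho g x)

include h0Θ in
/-- The in-page tube map restricts to `K` on the zero section. [folklore] -/
theorem inPageAmb_zero (ψ : sphere (0 : EuclideanSpace ℝ (Fin 2)) 1) :
    inPageAmb Θ K m (ψ, 0) = (K ψ).1 := by
  rw [inPageAmb, h0Θ]

include hrhoΘ in
/-- `rho` along the in-page tube map. [folklore] -/
theorem rho_inPageAmb (q : sphere (0 : EuclideanSpace ℝ (Fin 2)) 1 × ℝ) :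
    rho g (inPageAmb Θ K m q) = rho g (K q.1).1 := hrhoΘ _ _

include hwΘ in
/-- `w` along the in-page tube map. [folklore] -/
theorem w_inPageAmb (q : sphere (0 : EuclideanSpace ℝ (Fin 2)) 1 × ℝ) :
    w g (inPageAmb Θ K m q) = w g (K q.1).1 := hwΘ _ _

include h0Θ h0θ in
/-- **The tube map restricts to `K` on the zero section.** [folklore] -/
theorem tubeAmb_zero (ψ : sphere (0 : EuclideanSpace ℝ (Fin 2)) 1) :
    tubeAmb θ Θ K m (ψ, 0) = (K ψ).1 := by
  simp only [tubeAmb, PiLp.zero_apply, inPageAmb_zero h0Θ, h0θ]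

include hrhoΘ hrhoθ in
/-- **The tube map of a page curve takes values on the boundary level `{rho = 1/4}`.**
[folklore] -/
theorem rho_tubeAmb_eq (hc : ‖c‖ = 1) (hKc : ∀ θ, K θ ∈ page g c)
    (q : sphere (0 : EuclideanSpace ℝ (Fin 2)) 1 × EuclideanSpace ℝ (Fin 2)) :
    rho g (tubeAmb θ Θ K m q) = 1 / 4 := by
  rw [tubeAmb, hrhoθ, rho_inPageAmb hrhoΘ]
  exact rho_eq_of_mem_page g hc (hKc q.1)

/-- **The tube map, corestricted to the boundary 3-manifold `∂ Base g`** (given that its values lie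
on `{rho = 1/4}`). [cite: Kosinski1993, III (3.1)] -/
def tubeMap (hmem : ∀ q, rho g (tubeAmb θ Θ K m q) = 1 / 4) :
    sphere (0 : EuclideanSpace ℝ (Fin 2)) 1 × EuclideanSpace ℝ (Fin 2) → (bBase g).carrier :=
  ((𝓡∂ 4).boundary (Base g)).codRestrict
    (fun q => (RegularSublevel.mk (isRegularLevel_rho g) (tubeAmb θ Θ K m q) (hmem q).le : Base g))
    fun q => (RegularSublevel.mem_boundary_iff (isRegularLevel_rho g) _).2 (hmem q)

/-- The tube map into `∂ Base g`, read in `ℝ⁴`. [folklore] -/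
@[simp] theorem coe_tubeMap (hmem : ∀ q, rho g (tubeAmb θ Θ K m q) = 1 / 4)
    (q : sphere (0 : EuclideanSpace ℝ (Fin 2)) 1 × EuclideanSpace ℝ (Fin 2)) :
    ((bBase g).incl (tubeMap hmem q)).1 = tubeAmb θ Θ K m q := rfl

/-- **The tube map into `∂ Base g` is smooth** for the boundary structure (smooth into `ℝ⁴` with
values in the regular domain `Base g`, `HalfSliceAtlas.contMDiff_codRestrict`, and in its boundary,
`BoundaryManifold.contMDiff_codRestrict`). [cite: LeeSmoothManifolds2013, Cor. 5.30] -/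
theorem contMDiff_tubeMap (hmem : ∀ q, rho g (tubeAmb θ Θ K m q) = 1 / 4)
    (hsm : ContMDiff ((𝓡 1).prod 𝓘(ℝ, EuclideanSpace ℝ (Fin 2))) 𝓘(ℝ, EuclideanSpace ℝ (Fin 4)) ∞
      (tubeAmb θ Θ K m)) :
    ContMDiff ((𝓡 1).prod 𝓘(ℝ, EuclideanSpace ℝ (Fin 2))) (𝓡 3) ∞ (tubeMap hmem) := by
  have h1 : ContMDiff ((𝓡 1).prod 𝓘(ℝ, EuclideanSpace ℝ (Fin 2))) (𝓡∂ 4) ∞ fun q =>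
      (RegularSublevel.mk (isRegularLevel_rho g) (tubeAmb θ Θ K m q) (hmem q).le : Base g) :=
    (RegularSublevel.halfSliceAtlas (isRegularLevel_rho g)).contMDiff_codRestrict
      (fun q => show tubeAmb θ Θ K m q ∈ rho g ⁻¹' Iic (1 / 4) from (hmem q).le) hsm
  exact BoundaryManifold.contMDiff_codRestrict (W := Base g) _ h1

end Maps

/-! ## §4 The registered sub-goal: the in-page tube of a page curve -/

/-- **The in-page tubular neighbourhood map of a page curve** (registered sub-goal
`helper_pageTube_inPage` of NF6, brick T3c-1 (3b)): for a smooth embedding `K : 𝕊¹ → Base g` with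
values in the page `page g c` (`‖c‖ = 1`) there is a smooth map `P : 𝕊¹ × ℝ → ℝ⁴` with `P (ψ, 0) = K ψ`,
with values on the boundary level `{rho = 1/4}` and in the complex curve `{w = c/2}` of the page (so
in `page g c` wherever it stays in the flat part `‖x‖² < 4`, in particular near the zero section),
whose fibre velocity at the zero section is a POSITIVE multiple of the in-page normal `i K'` of the
curve: `∂ₐ P (e^{2πit}, a) |_{a=0} = r · i (ambCurve g K)'(t)`, `r > 0` — the first coordinate of
the page-adapted tube (Kosinski 1993, III (3.1)), realised as the flow of the in-page field of
`helper_pageField_flow`. [cite: Kosinski1993, III (3.1)] -/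
theorem helper_pageTube_inPage : ∀ (g : ℕ) (c : ℂ)
    (K : Metric.sphere (0 : EuclideanSpace ℝ (Fin 2)) 1 →
      Literature.Topology.FourManifolds.LefschetzBase.Base g),
    ‖c‖ = 1 → Manifold.IsSmoothEmbedding (𝓡 1) (𝓡∂ 4) ∞ K →
    (∀ θ, K θ ∈ Literature.Topology.FourManifolds.LefschetzBase.page g c) →
    ∃ (P : Metric.sphere (0 : EuclideanSpace ℝ (Fin 2)) 1 × ℝ → EuclideanSpace ℝ (Fin 4)) (r : ℝ),
      0 < r ∧ ContMDiff ((𝓡 1).prod 𝓘(ℝ, ℝ)) 𝓘(ℝ, EuclideanSpace ℝ (Fin 4)) ∞ P ∧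
      (∀ ψ, P (ψ, 0) = (K ψ).1) ∧
      (∀ q, Literature.Topology.FourManifolds.LefschetzBase.rho g (P q) = 1 / 4) ∧
      (∀ q, Literature.Topology.FourManifolds.LefschetzBase.w g (P q) = c / 2) ∧
      (∀ t, HasDerivAt (fun a => P (Literature.Topology.FourManifolds.circlePt t, a))
        (r • Literature.Topology.FourManifolds.LefschetzBase.cplxJ
          (deriv (Literature.Topology.FourManifolds.LefschetzBase.ambCurve g K) t)) 0) := by
  intro g c K hc hK hKc
  obtain ⟨δ, hδ, hδK⟩ := exists_width hK.contMDiff hKc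
  obtain ⟨C, hC, hCK⟩ := exists_norm_mPar_le (g := g) hK.contMDiff
  obtain ⟨Θ, hΘ, h0, -, hder, hsnd, hrho, hw⟩ := helper_pageField_flow g δ hδ
  refine ⟨inPageAmb Θ K (mPar g K C), C⁻¹, inv_pos.2 hC,
    contMDiff_inPageAmb hΘ hK.contMDiff (contMDiff_mPar hK.contMDiff C), inPageAmb_zero h0,
    fun q => (rho_inPageAmb hrho q).trans (rho_eq_of_mem_page g hc (hKc q.1)),
    fun q => (w_inPageAmb hw q).trans (hKc q.1).2, fun t => ?_⟩
  -- the fibre velocity at the zero section is the field at `(K, mPar)`, i.e. `C⁻¹ · i K'`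
  set z : EuclideanSpace ℝ (Fin 4) × ℂ := ((K (circlePt t)).1, mPar g K C (circlePt t)) with hz
  have h1 : HasDerivAt (fun a => (Θ (a, z)).1) (pageFieldP g δ (Θ (0, z))).1 0 :=
    hasDerivAt_fst_pageFlowline (hder z) 0
  rw [h0] at h1
  have hcut : tubeCut g δ z = 1 := by
    rw [tubeCut, cutA_of_le (by rw [rho_eq_of_mem_page g hc (hKc _)]; norm_num),
      flatCut_of_le hδ (hδK _), parCut_of_le (hCK _), one_mul, one_mul]
  have hval : (pageFieldP g δ z).1 = C⁻¹ • cplxJ (deriv (ambCurve g K) t) := by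
    rw [pageFieldP_fst, hcut, one_smul]
    exact kerVec_mPar hK.contMDiff hKc C t
  rw [hval] at h1
  exact h1

end Summit.SmoothPoincare4.SmoothPoincare4.Theorems.AcyclicBisectionExists.ModpBraidOrbits
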